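import Summits.BirchSwinnertonDyer.BirchSwinnertonDyer.Theorems.ByReductionTypeAtTwoAdditiveReducibleKatoMemberSharpNST
import Summits.BirchSwinnertonDyer.BirchSwinnertonDyer.Theses.ByReductionTypeAtTwo
import HarnessLib

/-!
# Route ByReductionTypeAtTwo (K4): the P4-V2 glue `AdditivePotGoodReducibleRestAtTwoOfInputs` of child C2″ closed BY NAME

Seat `bsd-2adic-k4-w2` GEN 6 (prover, explicit unit, cell `bsd-2adic`, HOME `run/shared/lean/pub/bsd-2adic/`; pen package
P4 «ADD-RED TURNKEY» V2, RC-352 / RC-367, director (306) «GO P4»). HONEST FRAMING: BSD is not proved by any of this, and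
the child C2″ `AdditivePotGoodReducibleRestAtTwo` (stmt-BirchSwinnertonDyer-22616) keeps its UNCONDITIONAL statement and is
NOT proved here — this file proves only the generated glue item stmt-BirchSwinnertonDyer-23906

  `AdditivePrintedInputsAtTwo → AddRedSharpCountReadingAtTwo → AdditivePotGoodReducibleRestAtTwo`,

i.e. «the published inputs (item 22619, eleven heads BY NAME) and the SHARP (NST′) member-package reading of Kato 2004 at
`p = 2` (item 23905 = `Kato2004.exists_memberHullInputs_two_sharp_of_noSplitTwistNegOneNegTwo`, audit-2 GEN 56 D-AUDIT hMH2♯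
PASS, AS-PRINTED/EXACT) imply C2″», by ONE application of the landed conditional closing theorem
`AddKatoTwo.additivePotGoodReducibleRestAtTwo_of_sharpMember` (p673737, seat GEN 4) after the pure-logic step
`AddKatoTwo.exists_memberHullInputs_two_sharp_of_noSplitTwistSharp` (p674406 §0: (NST′)-sharp ⟹ potentially-good-sharp).
Of the eleven heads of `AdditivePrintedInputsAtTwo` six are consumed (GZK rank, modularity of `L(E,s)`, Lim 2017 Thm 3.5 at
`2`, Ferrero–Washington, the newform attached to `E`, Cassels' isogeny invariance); the others ride along unused (the bundle is
shared with the sibling glues). The pen's certificate `plan/addred-turnkey-v1/CertAddRedTurnkeyV1.lean` and refuter b6's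
attached candidate `Glue.lean` (evidence on 23906, farm rc 0) are the same term.

References: [Kato2004Asterisque] Thm. 12.4–12.6, (12.5.1), Lemma 13.10, 13.13, Thm. 14.5, §14.8, Prop. 14.16 (2);
[GreenbergLNM1716] Prop. 4.13; [MazurRubin2004] Thm. 2.3.4; [Lim2017FineSelmer] Thm. 3.5; [FerreroWashington1979];
[Cassels1965ArithmeticVIII]; [Miller2011LMS] Def. 1.1. Memo `run/shared/lean/pub/bsd-2adic/k4w2/gen4/READING-hMH2sharp-count-2t.md`.
-/

set_option autoImplicit false
set_option linter.dupNamespace false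

namespace Summit.BirchSwinnertonDyer.BirchSwinnertonDyer.Theorems

open Summit.BirchSwinnertonDyer.BirchSwinnertonDyer.Theses.ByReductionTypeAtTwo

/-- **K4 glue `AdditivePotGoodReducibleRestAtTwoOfInputs` (route `ByReductionTypeAtTwo`, item stmt-BirchSwinnertonDyer-23906,
parent child C2″ `AdditivePotGoodReducibleRestAtTwo` of crux `AdditiveRankZeroAtTwo`), proved by name:**
`AdditivePrintedInputsAtTwo → AddRedSharpCountReadingAtTwo → AdditivePotGoodReducibleRestAtTwo`. The published bundle is
destructured into its heads (positions: 1 GZK `rank_eq_analyticRank_of_analyticRank_le_one`, 2 `hasEntireLFunction_rat`,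
5 Lim 2017 Thm 3.5 at `2`, 6 Ferrero–Washington, 8 `exists_isNewformOf`, 10 Cassels `bsdRHS_eq_of_isIsogenous`); the sharp
(NST′) head is weakened to the potentially-good sharp head (`AddKatoTwo.exists_memberHullInputs_two_sharp_of_noSplitTwistSharp`,
p674406 §0) and fed to `AddKatoTwo.additivePotGoodReducibleRestAtTwo_of_sharpMember` (p673737), whose conclusion is the route
decl C2″ verbatim. Nothing else is asserted; C2″ itself stays an open UNCONDITIONAL item and BSD is not proved.
[cite: Kato2004Asterisque, Prop. 14.16 (2)] [cite: Cassels1965ArithmeticVIII] -/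
theorem additivePotGoodReducibleRestAtTwoOfInputs_proof : AdditivePotGoodReducibleRestAtTwoOfInputs := by
  intro hPub hinS
  obtain ⟨hGZK, hrat, _, _, hLim2, hFW, _, hmodN, _, hCassels, _⟩ := hPub
  exact AddKatoTwo.additivePotGoodReducibleRestAtTwo_of_sharpMember hmodN hrat
    (AddKatoTwo.exists_memberHullInputs_two_sharp_of_noSplitTwistSharp hinS) hLim2 hFW hCassels hGZK

end Summit.BirchSwinnertonDyer.BirchSwinnertonDyer.Theorems
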